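import Summits.ResolutionOfSingularities.ResolutionOfSingularities.Theorems.WeightedInvariantE2CoreInvariance
import Summits.ResolutionOfSingularities.ResolutionOfSingularities.Theorems.WeightedInvariantGradedChartAlgebra
import Summits.ResolutionOfSingularities.ResolutionOfSingularities.Theorems.WeightedInvariantHypersurfaceCentreAssemblyStalkDict
import Summits.ResolutionOfSingularities.ResolutionOfSingularities.Theorems.WeightedInvariantHypersurfaceCentreAssemblyPointDict
import Summits.ResolutionOfSingularities.ResolutionOfSingularities.Theorems.WeightedInvariantIotaSqueeze
import Summits.ResolutionOfSingularities.ResolutionOfSingularities.Theorems.WeightedInvariantHypersurfaceLocalGameEFT4SDimLEDoorGradedHom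
import HarnessLib

/-!
# E2 centre, word (G-6b) `e2CentreHom`: LEMMA H, step (b) — CORE INVARIANCE AT SCHEME LEVEL for an arbitrary grading of an
# affine open making the hypersurface ideal homogeneous (the CORE POINT `y*` of a point `y`: `y* ⤳ y`, `ι(y*) = ι(y)`,
# `y ∈ singImage → y* ∈ singImage`, `dim 𝒪_{y*} ≤ dim 𝒪_y`)

Route `ResolutionOfSingularities/WeightedInvariant`, crux `Theses.WeightedInvariant.HypersurfaceCentreConstruction`
(stmt-ResolutionOfSingularities-19897), door line `local-engine` (skeleton v3.12), E2 tier, registered stub `stub_e2_centre_h`, resting on the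
single word (G-6b) (`…ELadderTwoCentreOfHom`); proof route «LEMMA H» (`Cruxes/HypersurfaceCentreConstruction/G6B-LEMMA-H.md`), step (b):
«by core invariance `ι(𝒪_{η*}, f) = ι(𝒪_η, f) = mu₂` and `f` is singular at `η*`».  The ring-level core invariance is res-L1-s36-pv-1's
`E2Model.iota_localization_homogeneousCore_eq` / `mem_pow_maximalIdeal_localization_homogeneousCore_iff` (…E2CoreInvariance, generic translate);
this file reads it on the SCHEME: for `Y` smooth over a field, `X` locally principal, an affine open `U` with a `ℤʲ`-grading `𝒜` of `Γ(Y, U)`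
making `X(U)` homogeneous, and `y ∈ U`:
* `exists_point_primeIdealOf_eq`, `specializes_of_primeIdealOf_le` — points of an affine open with prescribed prime; specialisation from primes;
* `exists_isHomogeneousElem_map_eq_span_of_isHomogeneous` — a HOMOGENEOUS `F ∈ X(U)` with `X(U)·A_𝔮 = (F)` for every prime `𝔮 ∌ g'`
  of a homogeneous `g' ∉ 𝔭(y)` (…GradedChartAlgebra);
* `iotaAt_eq_iota_localization_of_map_eq`, `mem_singImage_iff_algebraMap_mem_sq_of_map_eq` — the stalk dictionary from the weaker datum
  `X(U)·A_{𝔭(y)} = (F/1)` (instead of `X(U) = (F)`);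
* **`exists_corePoint`** — THE CORE POINT: under (c6), (c11)≤d, (c12a), for `y ∈ U` with `dim 𝒪_{Y,y} ≤ d` there is `y* ∈ U` with
  `𝔭(y*) = core_𝒜 𝔭(y)` (so `𝔭(y*)` is `𝒜`-homogeneous), `y* ⤳ y`, `dim 𝒪_{y*} ≤ dim 𝒪_y`, `iotaAt ι X y* = iotaAt ι X y`, and
  `y ∈ singImage X → y* ∈ singImage X`.
Def-free helper (`--supports stmt-ResolutionOfSingularities-19897`); nothing here asserts any clause or anything about resolution of singularities in
characteristic `p`; AI-written, weaker than expert review. [OURS · L1 W4.3]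
-/

noncomputable section

set_option linter.dupNamespace false -- mandated namespace of this single-conjunct summit

open CategoryTheory AlgebraicGeometry TopologicalSpace IsLocalRing Topology
open Literature.AlgebraicGeometry.Resolution
open Summit.ResolutionOfSingularities.ResolutionOfSingularities.Theorems
open Summit.ResolutionOfSingularities.ResolutionOfSingularities.Theorems.GradedChart

namespace Summit.ResolutionOfSingularities.ResolutionOfSingularities.Cruxes.HypersurfaceCentreConstruction.LocalEngine

/-! ## Points of an affine open and their primes -/

section Points

variable {Y : Scheme.{0}} (U : Y.affineOpens)

/-- The point of the affine open `U` with a prescribed prime of `Γ(Y, U)`. [folklore] -/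
theorem exists_point_primeIdealOf_eq (P : Ideal Γ(Y, U)) (hP : P.IsPrime) :
    ∃ (y : Y) (hy : y ∈ (U : Y.Opens)), (U.2.primeIdealOf ⟨y, hy⟩).asIdeal = P := by
  set q : PrimeSpectrum Γ(Y, U) := ⟨P, hP⟩ with hq
  have hy : (U.2.fromSpec q : Y) ∈ (U : Y.Opens) := U.2.range_fromSpec.le ⟨q, rfl⟩
  refine ⟨_, hy, ?_⟩
  have h : U.2.primeIdealOf ⟨U.2.fromSpec q, hy⟩ = q := by
    apply U.2.fromSpec.isOpenEmbedding.injective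
    rw [IsAffineOpen.fromSpec_primeIdealOf]
  rw [h]

/-- On an affine open, `𝔭(y') ≤ 𝔭(y)` gives `y' ⤳ y`. [folklore] -/
theorem specializes_of_primeIdealOf_le {y y' : Y} (hy : y ∈ (U : Y.Opens)) (hy' : y' ∈ (U : Y.Opens))
    (h : (U.2.primeIdealOf ⟨y', hy'⟩).asIdeal ≤ (U.2.primeIdealOf ⟨y, hy⟩).asIdeal) : y' ⤳ y := by
  have key := U.2.fromSpec.isOpenEmbedding.isInducing.specializes_iff
    (x := U.2.primeIdealOf ⟨y', hy'⟩) (y := U.2.primeIdealOf ⟨y, hy⟩)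
  rw [IsAffineOpen.fromSpec_primeIdealOf, IsAffineOpen.fromSpec_primeIdealOf] at key
  have h1 : U.2.primeIdealOf ⟨y', hy'⟩ ⤳ U.2.primeIdealOf ⟨y, hy⟩ :=
    (PrimeSpectrum.le_iff_specializes _ _).mp ((PrimeSpectrum.asIdeal_le_asIdeal _ _).mp h)
  exact key.mpr h1

end Points

/-! ## Extension of an ideal to `A_P` from a common denominator -/

section Denominator

variable {A : Type*} [CommRing A]

/-- If `F ∈ I` and some `g' ∉ P` multiplies `I` into `(F)`, then `I·A_P = (F/1)`. [folklore] -/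
theorem map_localization_eq_span_of_smul_le (I : Ideal A) (P : Ideal A) [P.IsPrime] {F g' : A} (hF : F ∈ I)
    (hg' : g' ∉ P) (h : ∀ x ∈ I, g' * x ∈ Ideal.span {F}) :
    I.map (algebraMap A (Localization.AtPrime P)) = Ideal.span {algebraMap A (Localization.AtPrime P) F} := by
  apply le_antisymm
  · rw [Ideal.map_le_iff_le_comap]
    intro x hx
    rw [Ideal.mem_comap, Ideal.mem_span_singleton]
    obtain ⟨c, hc⟩ := Ideal.mem_span_singleton'.mp (h x hx)
    have hu : IsUnit (algebraMap A (Localization.AtPrime P) g') :=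
      IsLocalization.map_units (M := P.primeCompl) (Localization.AtPrime P) ⟨g', hg'⟩
    refine ⟨algebraMap A _ c * ↑(hu.unit⁻¹), ?_⟩
    have e1 : algebraMap A (Localization.AtPrime P) (g' * x) = algebraMap A _ c * algebraMap A _ F := by
      rw [← map_mul, hc]
    rw [map_mul] at e1
    calc algebraMap A (Localization.AtPrime P) x
        = ↑(hu.unit⁻¹) * (algebraMap A _ g' * algebraMap A _ x) := by
          rw [← mul_assoc, IsUnit.val_inv_mul, one_mul]
      _ = algebraMap A _ F * (algebraMap A _ c * ↑(hu.unit⁻¹)) := by rw [e1]; ring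
  · rw [Ideal.span_le, Set.singleton_subset_iff]
    exact Ideal.mem_map_of_mem _ hF

end Denominator

/-! ## The stalk dictionary from the datum `X(U)·A_{𝔭(y)} = (F/1)` -/

section Dict

variable (ι : (R : Type) → [CommRing R] → R → Ordinal.{0})
  {Y : Scheme.{0}} (X : Y.IdealSheafData) (U : Y.affineOpens) {y : Y} (hy : y ∈ (U : Y.Opens))

/-- If `X(U)·A_𝔮 = (F/1)` (`𝔮` the prime of `y ∈ U`) then the germ of `F` generates the stalk ideal `X_y`. [folklore] -/
theorem stalkIdeal_eq_span_germ_of_map_eq {F : Γ(Y, U)}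
    (hFmap : (X.ideal U).map (algebraMap Γ(Y, U) (Localization.AtPrime (U.2.primeIdealOf ⟨y, hy⟩).asIdeal)) =
      Ideal.span {algebraMap Γ(Y, U) (Localization.AtPrime (U.2.primeIdealOf ⟨y, hy⟩).asIdeal) F}) :
    stalkIdeal X y = Ideal.span {(Y.presheaf.germ (U : Y.Opens) y hy).hom F} := by
  rw [stalkIdeal_eq_map_germ X U hy, ← map_stalkEquiv_map U hy, hFmap, Ideal.map_span, Set.image_singleton]
  congr 2
  exact stalkEquiv_algebraMap U hy F

/-- **`ι` at a point, read on the localized model, from `X(U)·A_𝔮 = (F/1)`** (for `Y → Spec k` smooth; (c6) along `stalkEquiv`, (c12a)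
for the two local equations). [folklore] -/
theorem iotaAt_eq_iota_localization_of_map_eq {k : Type} [Field k] (f : Y ⟶ Spec (.of k)) [Smooth f]
    (hc6 : IotaIsoInvariant ι) (hu : IotaUnitInvariant ι) {F : Γ(Y, U)}
    (hFmap : (X.ideal U).map (algebraMap Γ(Y, U) (Localization.AtPrime (U.2.primeIdealOf ⟨y, hy⟩).asIdeal)) =
      Ideal.span {algebraMap Γ(Y, U) (Localization.AtPrime (U.2.primeIdealOf ⟨y, hy⟩).asIdeal) F}) :
    iotaAt ι X y = ι (Localization.AtPrime (U.2.primeIdealOf ⟨y, hy⟩).asIdeal)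
      (algebraMap Γ(Y, U) (Localization.AtPrime (U.2.primeIdealOf ⟨y, hy⟩).asIdeal) F) := by
  haveI : IsRegularLocalRing (Y.presheaf.stalk y) := isRegularLocalRing_stalk_of_smooth_of_field f y
  haveI : IsDomain (Y.presheaf.stalk y) := isDomain_of_isRegularLocalRing (Y.presheaf.stalk y)
  have hst := stalkIdeal_eq_span_germ_of_map_eq X U hy hFmap
  have hgen : Ideal.span {localGenerator X y} = Ideal.span {(Y.presheaf.germ (U : Y.Opens) y hy).hom F} := by
    rw [← stalkIdeal_eq_span_localGenerator X y ⟨_, hst⟩, hst]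
  unfold iotaAt
  rw [iota_eq_of_span_singleton_eq ι hu hgen, ← stalkEquiv_algebraMap U hy F]
  exact hc6 _ _ (stalkEquiv U hy) _

/-- **`y ∈ singImage X ↔ F/1 ∈ 𝔪²`, from `X(U)·A_𝔮 = (F/1)`** (for `𝒪_{Y,y}` regular and `F/1 ≠ 0`). [cite: Matsumura1987, Thm. 14.2] -/
theorem mem_singImage_iff_algebraMap_mem_sq_of_map_eq [IsRegularLocalRing (Y.presheaf.stalk y)] {F : Γ(Y, U)}
    (hFmap : (X.ideal U).map (algebraMap Γ(Y, U) (Localization.AtPrime (U.2.primeIdealOf ⟨y, hy⟩).asIdeal)) =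
      Ideal.span {algebraMap Γ(Y, U) (Localization.AtPrime (U.2.primeIdealOf ⟨y, hy⟩).asIdeal) F})
    (h0 : algebraMap Γ(Y, U) (Localization.AtPrime (U.2.primeIdealOf ⟨y, hy⟩).asIdeal) F ≠ 0) :
    y ∈ singImage X ↔
      algebraMap Γ(Y, U) (Localization.AtPrime (U.2.primeIdealOf ⟨y, hy⟩).asIdeal) F ∈
        maximalIdeal (Localization.AtPrime (U.2.primeIdealOf ⟨y, hy⟩).asIdeal) ^ 2 := by
  rw [algebraMap_mem_maximalIdeal_pow_iff_germ_mem]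
  refine mem_singImage_iff_mem_sq_of_stalkIdeal_eq X (stalkIdeal_eq_span_germ_of_map_eq X U hy hFmap) fun h => h0 ?_
  rwa [algebraMap_eq_zero_iff_germ_eq_zero]

end Dict

/-! ## A homogeneous local generator of `X(U)` at a point, for an arbitrary grading making `X(U)` homogeneous -/

section Generator

variable {Y : Scheme.{0}} (X : Y.IdealSheafData) (hX : IsLocallyPrincipal X) (U : Y.affineOpens) {y : Y}
  (hy : y ∈ (U : Y.Opens)) {j : ℕ} (𝒜 : (Fin j → ℤ) → AddSubgroup Γ(Y, U)) [GradedRing 𝒜]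

include hX in
/-- **A HOMOGENEOUS local generator with a homogeneous common denominator.**  If `X` is locally principal and `X(U)` is `𝒜`-homogeneous
(`Γ(Y, U)` Noetherian), then at `y ∈ U` there are a homogeneous `F ∈ X(U)` and a homogeneous `g' ∉ 𝔭(y)` with `g'·X(U) ⊆ (F)`; hence
`X(U)·A_𝔮 = (F/1)` for EVERY prime `𝔮 ∌ g'`. [folklore] -/
theorem exists_isHomogeneousElem_localGenerator [IsNoetherianRing Γ(Y, U)] (hXhom : (X.ideal U).IsHomogeneous 𝒜) :
    ∃ F g' : Γ(Y, U), F ∈ X.ideal U ∧ SetLike.IsHomogeneousElem 𝒜 F ∧ SetLike.IsHomogeneousElem 𝒜 g' ∧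
      g' ∉ (U.2.primeIdealOf ⟨y, hy⟩).asIdeal ∧ ∀ x ∈ X.ideal U, g' * x ∈ Ideal.span {F} := by
  set P := (U.2.primeIdealOf ⟨y, hy⟩).asIdeal with hP
  haveI : P.IsPrime := (U.2.primeIdealOf ⟨y, hy⟩).2
  -- the stalk ideal is principal
  obtain ⟨U', hyU', G, hG⟩ := hX y
  have hprinc : stalkIdeal X y = Ideal.span {(Y.presheaf.germ (U' : Y.Opens) y hyU').hom G} :=
    stalkIdeal_eq_span_germ (hy := hyU') X hG
  letI := TopCat.Presheaf.algebra_section_stalk Y.presheaf (⟨y, hy⟩ : (U : Y.Opens))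
  haveI hloc : IsLocalization.AtPrime (Y.presheaf.stalk y) P := U.2.isLocalization_stalk ⟨y, hy⟩
  have hmapL : (X.ideal U).map (algebraMap Γ(Y, U) (Y.presheaf.stalk y)) =
      Ideal.span {(Y.presheaf.germ (U' : Y.Opens) y hyU').hom G} := by
    rw [← hprinc, stalkIdeal_eq_map_germ X U hy]
    rfl
  obtain ⟨F, hFI, hFh, hFmap⟩ := exists_isHomogeneousElem_map_eq_span 𝒜 hXhom hmapL
  -- transfer to `Localization.AtPrime P`
  let e : Y.presheaf.stalk y ≃ₐ[Γ(Y, U)] Localization.AtPrime P :=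
    IsLocalization.algEquiv P.primeCompl (Y.presheaf.stalk y) (Localization.AtPrime P)
  have hFmap' : (X.ideal U).map (algebraMap Γ(Y, U) (Localization.AtPrime P)) =
      Ideal.span {algebraMap Γ(Y, U) (Localization.AtPrime P) F} := by
    have hcomp : algebraMap Γ(Y, U) (Localization.AtPrime P) =
        (e : Y.presheaf.stalk y →+* Localization.AtPrime P).comp (algebraMap Γ(Y, U) (Y.presheaf.stalk y)) := by
      ext x
      exact (e.commutes x).symm
    rw [hcomp, ← Ideal.map_map, hFmap, Ideal.map_span, Set.image_singleton, RingHom.comp_apply]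
  obtain ⟨g', hg'h, hg'P, hg'⟩ := exists_isHomogeneousElem_not_mem_smul_le 𝒜 hXhom P hFh hFmap'
  exact ⟨F, g', hFI, hFh, hg'h, hg'P, hg'⟩

end Generator

/-! ## THE CORE POINT -/

section CorePoint

variable (ι : (R : Type) → [CommRing R] → R → Ordinal.{0}) (J : (R : Type) → [CommRing R] → R → ℕ → Ideal R)
  {d : ℕ} {k : Type} [Field k] {Y : Scheme.{0}} (f : Y ⟶ Spec (.of k)) [Smooth f]
  (X : Y.IdealSheafData) (hX : IsLocallyPrincipal X) (U : Y.affineOpens)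
  {j : ℕ} (𝒜 : (Fin j → ℤ) → AddSubgroup Γ(Y, U)) [GradedRing 𝒜]

/-- `F/1 ≠ 0` descends from `A_𝔮` (a domain) to `A_{𝔮'}` for `𝔮' ≤ 𝔮`. [folklore] -/
theorem algebraMap_ne_zero_of_le {A : Type*} [CommRing A] {𝔮 𝔮' : Ideal A} [𝔮.IsPrime] [𝔮'.IsPrime] (hle : 𝔮' ≤ 𝔮)
    [IsDomain (Localization.AtPrime 𝔮)] {F : A} (h0 : algebraMap A (Localization.AtPrime 𝔮) F ≠ 0) :
    algebraMap A (Localization.AtPrime 𝔮') F ≠ 0 := by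
  intro h
  obtain ⟨⟨s, hs⟩, hsF⟩ := (IsLocalization.map_eq_zero_iff 𝔮'.primeCompl (Localization.AtPrime 𝔮') F).mp h
  have hs0 : algebraMap A (Localization.AtPrime 𝔮) s ≠ 0 := by
    intro hs0
    obtain ⟨⟨t, ht⟩, hts⟩ := (IsLocalization.map_eq_zero_iff 𝔮.primeCompl (Localization.AtPrime 𝔮) s).mp hs0
    have hts' : t * s ∈ 𝔮' := by simp only at hts; rw [hts]; exact 𝔮'.zero_mem
    rcases (‹𝔮'.IsPrime›.mem_or_mem hts') with h1 | h1
    · exact ht (hle h1)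
    · exact hs h1
  have : algebraMap A (Localization.AtPrime 𝔮) s * algebraMap A (Localization.AtPrime 𝔮) F = 0 := by
    rw [← map_mul]; simp only at hsF; rw [hsF, map_zero]
  rcases mul_eq_zero.mp this with h1 | h1
  · exact hs0 h1
  · exact h0 h1

include f hX in
/-- **THE CORE POINT of LEMMA H, step (b).**  Let `Y → Spec k` be smooth, `X` locally principal, `U` an affine open with a `ℤʲ`-grading `𝒜` of
`Γ(Y, U)` making `X(U)` homogeneous, and let `ι` satisfy (c6), (c11)≤d (`IotaJEssSmoothCompatibleLE d ι J`) and (c12a).  For `y ∈ U` with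
`dim 𝒪_{Y,y} ≤ d` there is a point `y* ∈ U` whose prime is the HOMOGENEOUS CORE `core_𝒜 𝔭(y)`, with `y* ⤳ y`, `dim 𝒪_{Y,y*} ≤ dim 𝒪_{Y,y}`,
THE SAME `ι` (`iotaAt ι X y* = iotaAt ι X y`, by `E2Model.iota_localization_homogeneousCore_eq` on a homogeneous local generator), and
`y ∈ singImage X → y* ∈ singImage X` (order `≥ 2` is core-stable, `E2Model.mem_pow_maximalIdeal_localization_homogeneousCore_iff`). [folklore] -/
theorem exists_corePoint (hc6 : IotaIsoInvariant ι) (hc11 : IotaJEssSmoothCompatibleLE d ι J) (hu : IotaUnitInvariant ι)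
    (hXhom : (X.ideal U).IsHomogeneous 𝒜) {y : Y} (hy : y ∈ (U : Y.Opens)) (hd : ringKrullDim (Y.presheaf.stalk y) ≤ d) :
    ∃ (y' : Y) (hy' : y' ∈ (U : Y.Opens)),
      (U.2.primeIdealOf ⟨y', hy'⟩).asIdeal = (((U.2.primeIdealOf ⟨y, hy⟩).asIdeal).homogeneousCore 𝒜).toIdeal ∧
      ((U.2.primeIdealOf ⟨y', hy'⟩).asIdeal).IsHomogeneous 𝒜 ∧ y' ⤳ y ∧
      ringKrullDim (Y.presheaf.stalk y') ≤ ringKrullDim (Y.presheaf.stalk y) ∧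
      iotaAt ι X y' = iotaAt ι X y ∧ (y ∈ singImage X → y' ∈ singImage X) := by
  classical
  haveI : IsLocallyNoetherian Y := LocallyOfFiniteType.isLocallyNoetherian f
  haveI : IsNoetherianRing Γ(Y, U) := IsLocallyNoetherian.component_noetherian U
  set 𝔮 := (U.2.primeIdealOf ⟨y, hy⟩).asIdeal with h𝔮
  haveI : 𝔮.IsPrime := (U.2.primeIdealOf ⟨y, hy⟩).2
  set 𝔮c := (𝔮.homogeneousCore 𝒜).toIdeal with h𝔮c
  haveI h𝔮cp : 𝔮c.IsPrime := E2Model.isPrime_homogeneousCore 𝒜 (U.2.primeIdealOf ⟨y, hy⟩).2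
  have hle : 𝔮c ≤ 𝔮 := Ideal.toIdeal_homogeneousCore_le _ _
  obtain ⟨y', hy', hy'𝔮⟩ := exists_point_primeIdealOf_eq U 𝔮c h𝔮cp
  haveI : ((U.2.primeIdealOf ⟨y', hy'⟩).asIdeal).IsPrime := (U.2.primeIdealOf ⟨y', hy'⟩).2
  -- regularity and dimension at `y`, read on the model
  haveI : IsRegularLocalRing (Y.presheaf.stalk y) := isRegularLocalRing_stalk_of_smooth_of_field f y
  haveI hreg : IsRegularLocalRing (Localization.AtPrime 𝔮) := IsRegularLocalRing.of_ringEquiv (stalkEquiv U hy).symm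
  haveI : IsDomain (Localization.AtPrime 𝔮) := isDomain_of_isRegularLocalRing _
  haveI : IsRegularLocalRing (Y.presheaf.stalk y') := isRegularLocalRing_stalk_of_smooth_of_field f y'
  have hd𝔮 : ringKrullDim (Localization.AtPrime 𝔮) ≤ d := by
    rw [ringKrullDim_eq_of_ringEquiv (stalkEquiv U hy)]; exact hd
  -- a homogeneous local generator at `y`, valid at `y*` as well
  obtain ⟨F, g', hFI, hFh, -, hg'𝔮, hg'⟩ := exists_isHomogeneousElem_localGenerator X hX U hy 𝒜 hXhom
  have hFmap : (X.ideal U).map (algebraMap Γ(Y, U) (Localization.AtPrime 𝔮)) =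
      Ideal.span {algebraMap Γ(Y, U) (Localization.AtPrime 𝔮) F} :=
    map_localization_eq_span_of_smul_le (X.ideal U) 𝔮 hFI hg'𝔮 hg'
  have hFmap' : (X.ideal U).map (algebraMap Γ(Y, U) (Localization.AtPrime (U.2.primeIdealOf ⟨y', hy'⟩).asIdeal)) =
      Ideal.span {algebraMap Γ(Y, U) (Localization.AtPrime (U.2.primeIdealOf ⟨y', hy'⟩).asIdeal) F} :=
    map_localization_eq_span_of_smul_le (X.ideal U) _ hFI (fun h => hg'𝔮 (hle (hy'𝔮 ▸ h))) hg'
  refine ⟨y', hy', hy'𝔮, hy'𝔮 ▸ (𝔮.homogeneousCore 𝒜).isHomogeneous,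
    specializes_of_primeIdealOf_le U hy hy' (hy'𝔮 ▸ hle), ?_, ?_, ?_⟩
  · -- dimension
    rw [← ringKrullDim_eq_of_ringEquiv (stalkEquiv U hy'), ← ringKrullDim_eq_of_ringEquiv (stalkEquiv U hy)]
    have := E2Model.ringKrullDim_localization_homogeneousCore_le 𝒜 𝔮 (U.2.primeIdealOf ⟨y', hy'⟩).asIdeal hy'𝔮
    exact this
  · -- `ι`
    rw [iotaAt_eq_iota_localization_of_map_eq ι X U hy' f hc6 hu hFmap', iotaAt_eq_iota_localization_of_map_eq ι X U hy f hc6 hu hFmap]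
    exact E2Model.iota_localization_homogeneousCore_eq 𝒜 𝔮 (U.2.primeIdealOf ⟨y', hy'⟩).asIdeal hy'𝔮 hc11 hu hd𝔮 hFh
  · -- `singImage`
    intro hys
    have h0 : algebraMap Γ(Y, U) (Localization.AtPrime 𝔮) F ≠ 0 := by
      intro h0
      apply ne_zero_of_mem_singImage_of_stalkIdeal_eq X (stalkIdeal_eq_span_germ_of_map_eq X U hy hFmap) hys
      rwa [← algebraMap_eq_zero_iff_germ_eq_zero]
    have h2 := (mem_singImage_iff_algebraMap_mem_sq_of_map_eq X U hy hFmap h0).mp hys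
    have h0' : algebraMap Γ(Y, U) (Localization.AtPrime (U.2.primeIdealOf ⟨y', hy'⟩).asIdeal) F ≠ 0 :=
      algebraMap_ne_zero_of_le (hy'𝔮 ▸ hle) h0
    refine (mem_singImage_iff_algebraMap_mem_sq_of_map_eq X U hy' hFmap' h0').mpr ?_
    exact (E2Model.mem_pow_maximalIdeal_localization_homogeneousCore_iff 𝒜 𝔮 (U.2.primeIdealOf ⟨y', hy'⟩).asIdeal
      hy'𝔮 hFh 2).mpr h2

end CorePoint

end Summit.ResolutionOfSingularities.ResolutionOfSingularities.Cruxes.HypersurfaceCentreConstruction.LocalEngine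

end
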